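/-
Copyright (c) 2026. All rights reserved.
Released under Apache 2.0 license as described in the file LICENSE.
-/
import Literature.MathematicalPhysics.QuantumLattice.HartreeFockQuasiFreeCertificateTTPrime
import HarnessLib

/-!
# Kernel-checkable quasi-free (Hartree–Fock class) certificates: the integer data format and its
# decidable checks

Topic `MathematicalPhysics/QuantumLattice`, family `hubbard`. The tree's soundness theorem
`HartreeFock.energyDensityTT'_le_qfPlane` (`HartreeFockQuasiFreeCertificateTTPrime.lean`) turns ONE
translation-invariant quasi-free certificate — a cell `M`, a finitely supported superlattice kernel
`γ̃_σ(R)`, Frobenius bounds on its idempotency defect and the affine shrink — into a cap PLANE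
`e(t, t', U; n̄) ≤ t·K - t'·K_d + U·D` valid for all `t, t'` and all `U ≥ 0`. So far every such
certificate in the tree is a HYPOTHESIS (a "kernel-data claim node" recomputed by external readers,
`Certificates/HubbardSquare_doped_upper_qf1_kernel_rows440_442.lean`). This file is the first half of
a device that lets the Lean KERNEL evaluate small certificates (`decide`): the integer data format
and its Boolean checks. The companion file `HartreeFockQuasiFreeCertificateKernelCheck.lean` proves
that the checks imply the hypotheses of `energyDensityTT'_le_qfPlane`.

## The format (`QFK.Cert M r`)

* cell sides `M : Fin 2 → ℕ` (sites `Fin (M 0) × Fin (M 1)`), support radius `r` (the support is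
  the box `S = {R : |R i| ≤ r}`, `(2r+1)²` superlattice vectors, indexed by `u, v < 2r+1`,
  `R = (u - r, v - r)`);
* `P`, `W`, `tbl`: the pre-shrink kernel `γ̃_σ(R)[p, q] = g / 2^P` with INTEGER numerators `g`,
  packed in offset binary (`W` bits each) into ONE natural number `tbl` (the kernel reads an entry
  with `Nat.shiftRight` / `Nat.mod`, both GMP-accelerated — a `![…]` table is an order of magnitude
  slower under `decide`); entry order `(σ, u, v, p.1, p.2, q.1, q.2)`;
* `C σ a b : ℕ`: claimed bounds `2^{2P} ‖d_σ(T)‖_F ≤ C σ a b` on the scaled idempotency defect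
  `d_σ(T) = γ̃_σ(T) - Σ_R γ̃_σ(R) γ̃_σ(T - R)`, `T = (a - 2r, b - 2r)`, `a, b < 4r+1` (typed `Fin (2·(2r)+1)` so that the defect vectors are the box of radius `2r`);
* the claimed outputs `n, K, Kd, D : ℚ` (filling and the three plane coefficients of the SHRUNK
  kernel `γ_σ = a_σ γ̃_σ + b_σ δ_{R,0} 1`, `a_σ = 2^{2P}/(2^{2P} + 2Δ_σ)`, `b_σ = a_σ Δ_σ/2^{2P}`,
  `Δ_σ = Σ_{a,b} C σ a b` — this choice satisfies the three shrink inequalities of the soundness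
  theorem identically, so they need no check).

## The checks (all `Bool`, evaluated by `decide`)

`checkBasic` (`2 ≤ M i`, `0 < n < 2`), `checkSymm` (`γ̃_σ(-R) = γ̃_σ(R)ᵀ` and `C` symmetric under
`T ↦ -T`), `checkNumbers` (the exact rational recomputation of `n, K, Kd, D` from the integers equals
the claimed values) and, per spin `σ` and per ROW `a ≥ 2r` of defect vectors, `rowCheck σ a`
(`2^{4P} ‖d_σ(T)‖_F² ≤ (C σ a b)²` for all `b`; the rows `a < 2r` follow from `d_σ(-T) = d_σ(T)ᴴ`).
The row split keeps every `decide` within the default kernel budget (one row of a radius-4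
certificate on the `2 × 2` cell ≈ 10 s).

Everything here is computable and definitional; the only lemmas are the unfoldings of the
kernel-friendly loops (`sumFin_eq`, `of_allFin`). No named facts.

## References

* V. Bach, E. H. Lieb, J. P. Solovej, J. Stat. Phys. 76 (1994) 3, eqs. (2c.4), (2c.8). [BachLiebSolovej1994]
* A. Neumaier, *Complete search in continuous global optimization and constraint satisfaction*,
  Acta Numerica 13 (2004), §11 (certificates checked in exact arithmetic). [Neumaier2004CompleteSearch]
-/

namespace Literature.MathematicalPhysics.QuantumLattice

namespace HartreeFock

namespace QFK

open Finset

/-! ### §1 Kernel-friendly loops -/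

/-- `Σ_{i < n} f i` by structural recursion (the kernel evaluates it without `Finset` machinery).
[folklore] -/
def sumFin {α : Type*} [AddCommMonoid α] : (n : ℕ) → (Fin n → α) → α
  | 0, _ => 0
  | n + 1, f => sumFin n (fun i => f i.castSucc) + f (Fin.last n)

/-- `sumFin n f = Σ_i f i` (the structural loop is the `Finset` sum; exact-arithmetic certificate
checking by evaluation). [cite: Neumaier2004CompleteSearch, §11] -/
theorem sumFin_eq {α : Type*} [AddCommMonoid α] : ∀ (n : ℕ) (f : Fin n → α), sumFin n f = ∑ i, f i
  | 0, _ => by simp [sumFin]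
  | n + 1, f => by rw [sumFin, Fin.sum_univ_castSucc, sumFin_eq n]

/-- `∀ i < n, f i` by structural recursion. [folklore] -/
def allFin : (n : ℕ) → (Fin n → Bool) → Bool
  | 0, _ => true
  | n + 1, f => allFin n (fun i => f i.castSucc) && f (Fin.last n)

/-- `allFin n f = true` gives `f i = true` for every `i`. [cite: Neumaier2004CompleteSearch, §11] -/
theorem of_allFin : ∀ {n : ℕ} {f : Fin n → Bool}, allFin n f = true → ∀ i, f i = true
  | 0, _, _, i => i.elim0
  | n + 1, f, h, i => by
    rw [allFin, Bool.and_eq_true] at h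
    rcases Fin.eq_castSucc_or_eq_last i with ⟨j, rfl⟩ | rfl
    · exact of_allFin h.1 j
    · exact h.2

/-- The sites of the cell `M 0 × M 1` as pairs of `Fin` coordinates. [folklore] -/
abbrev Site (M : Fin 2 → ℕ) : Type := Fin (M 0) × Fin (M 1)

/-- `Σ_{p ∈ cell} f p` by structural recursion. [folklore] -/
def sumSite {α : Type*} [AddCommMonoid α] (M : Fin 2 → ℕ) (f : Site M → α) : α :=
  sumFin (M 0) fun x => sumFin (M 1) fun y => f (x, y)

/-- `sumSite M f = Σ_p f p`. [cite: Neumaier2004CompleteSearch, §11] -/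
theorem sumSite_eq {α : Type*} [AddCommMonoid α] (M : Fin 2 → ℕ) (f : Site M → α) :
    sumSite M f = ∑ p, f p := by
  rw [sumSite, Fintype.sum_prod_type, sumFin_eq]
  exact Finset.sum_congr rfl fun x _ => sumFin_eq _ _

/-- `∀ p ∈ cell, f p` by structural recursion. [folklore] -/
def allSite (M : Fin 2 → ℕ) (f : Site M → Bool) : Bool :=
  allFin (M 0) fun x => allFin (M 1) fun y => f (x, y)

/-- `allSite M f = true` gives `f p = true` for every site. [cite: Neumaier2004CompleteSearch, §11] -/
theorem of_allSite {M : Fin 2 → ℕ} {f : Site M → Bool} (h : allSite M f = true) (p : Site M) :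
    f p = true := by
  obtain ⟨x, y⟩ := p
  exact of_allFin (of_allFin h x) y

/-! ### §2 The integer certificate -/

/-- **A kernel-checkable quasi-free certificate** on the cell `M` with support radius `r`: packed
integer numerators of the pre-shrink kernel (`P`, `W`, `tbl`), claimed scaled Frobenius defect bounds
`C`, and the claimed outputs `n, K, Kd, D` (see the module docstring for the layout).
[cite: BachLiebSolovej1994, eq. (2c.4)] -/
structure Cert (M : Fin 2 → ℕ) (r : ℕ) where
  /-- dyadic scale: kernel entries are `g / 2^P` -/
  P : ℕ
  /-- bits per packed entry (offset binary) -/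
  W : ℕ
  /-- the packed table of integer numerators `g_σ(R)[p, q] + 2^(W-1)` -/
  tbl : ℕ
  /-- claimed bounds `2^{2P} ‖d_σ(T)‖_F ≤ C σ a b`, `T = (a - 2r, b - 2r)` -/
  C : Fin 2 → Fin (2 * (2 * r) + 1) → Fin (2 * (2 * r) + 1) → ℕ
  /-- claimed filling of the shrunk kernel -/
  n : ℚ
  /-- claimed `K = re qfCellEnergy 1 0 γ / |cell|` of the shrunk kernel -/
  K : ℚ
  /-- claimed `K_d = re qfCellDiag γ / |cell|` of the shrunk kernel -/
  Kd : ℚ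
  /-- claimed `D = re qfCellEnergy 0 1 γ / |cell|` of the shrunk kernel -/
  D : ℚ

variable {M : Fin 2 → ℕ} {r : ℕ} (c : Cert M r)

/-- Flat position of the entry `(σ, u, v, p, q)` in the packed table. [folklore] -/
def Cert.idx (_c : Cert M r) (σ : Fin 2) (u v : Fin (2 * r + 1)) (p q : Site M) : ℕ :=
  (((((σ.val * (2 * r + 1) + u.val) * (2 * r + 1) + v.val) * M 0 + p.1.val) * M 1 + p.2.val) * M 0
      + q.1.val) * M 1 + q.2.val

/-- **The integer numerator `g_σ(R)[p, q]`** of the pre-shrink kernel, `R = (u - r, v - r)`, decoded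
from the packed table (offset binary, `W` bits). [cite: BachLiebSolovej1994, eq. (2c.4)] -/
def Cert.g (σ : Fin 2) (u v : Fin (2 * r + 1)) (p q : Site M) : ℤ :=
  (((c.tbl >>> (c.W * c.idx σ u v p q)) % 2 ^ c.W : ℕ) : ℤ) - 2 ^ (c.W - 1)

/-- The numerator at an INTEGER superlattice vector `(R₀, R₁)`: the table value inside the box
`|Rᵢ| ≤ r`, zero outside. [cite: BachLiebSolovej1994, eq. (2c.4)] -/
def Cert.gZ (σ : Fin 2) (R₀ R₁ : ℤ) (p q : Site M) : ℤ :=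
  if h : -(r : ℤ) ≤ R₀ ∧ R₀ ≤ r ∧ -(r : ℤ) ≤ R₁ ∧ R₁ ≤ r then
    c.g σ ⟨(R₀ + r).toNat, by omega⟩ ⟨(R₁ + r).toNat, by omega⟩ p q
  else 0

/-- **The scaled idempotency defect** `2^{2P} d_σ(T)[p, q]`, `T = (a - 2r, b - 2r)`:
`2^P g_σ(T)[p,q]·[T ∈ S] - Σ_{R ∈ S, T-R ∈ S} Σ_j g_σ(R)[p,j] g_σ(T-R)[j,q]`.
[cite: BachLiebSolovej1994, eq. (2c.4)] -/
def Cert.dEntry (σ : Fin 2) (a b : Fin (2 * (2 * r) + 1)) (p q : Site M) : ℤ :=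
  (if h : r ≤ a.val ∧ a.val ≤ 3 * r ∧ r ≤ b.val ∧ b.val ≤ 3 * r then
      2 ^ c.P * c.g σ ⟨a.val - r, by omega⟩ ⟨b.val - r, by omega⟩ p q else 0) -
  sumFin (2 * r + 1) fun u => sumFin (2 * r + 1) fun v =>
    if h : u.val ≤ a.val ∧ a.val ≤ u.val + 2 * r ∧ v.val ≤ b.val ∧ b.val ≤ v.val + 2 * r then
      sumSite M fun j => c.g σ u v p j * c.g σ ⟨a.val - u.val, by omega⟩ ⟨b.val - v.val, by omega⟩ j q
    else 0

/-- The scaled Frobenius square `2^{4P} ‖d_σ(T)‖_F²`. [cite: BachLiebSolovej1994, eq. (2c.4)] -/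
def Cert.frob (σ : Fin 2) (a b : Fin (2 * (2 * r) + 1)) : ℤ :=
  sumSite M fun p => sumSite M fun q => c.dEntry σ a b p q ^ 2

/-- **Row check** of the defect bounds: `2^{4P} ‖d_σ(a - 2r, b - 2r)‖_F² ≤ (C σ a b)²` for all `b`
(one `decide` per `(σ, a)`, `a ≥ 2r`). [cite: Neumaier2004CompleteSearch, §11] -/
def Cert.rowCheck (σ : Fin 2) (a : Fin (2 * (2 * r) + 1)) : Bool :=
  allFin (2 * (2 * r) + 1) fun b => decide (c.frob σ a b ≤ (c.C σ a b : ℤ) ^ 2)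

/-- **Symmetry check**: `g_σ(-R) = g_σ(R)ᵀ` (so that `γ̃_σ(-R) = γ̃_σ(R)ᴴ`) and
`C σ (-T) = C σ T`. [cite: BachLiebSolovej1994, eq. (2c.4)] -/
def Cert.checkSymm : Bool :=
  (allFin 2 fun σ => allFin (2 * r + 1) fun u => allFin (2 * r + 1) fun v =>
    allSite M fun p => allSite M fun q =>
      decide (c.g σ ⟨2 * r - u.val, by omega⟩ ⟨2 * r - v.val, by omega⟩ q p = c.g σ u v p q)) &&
  (allFin 2 fun σ => allFin (2 * (2 * r) + 1) fun a => allFin (2 * (2 * r) + 1) fun b =>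
    decide (c.C σ ⟨4 * r - a.val, by omega⟩ ⟨4 * r - b.val, by omega⟩ = c.C σ a b))

/-- `Δ_σ = Σ_{a,b} C σ a b` (scaled total defect bound). [cite: BachLiebSolovej1994, eq. (2c.4)] -/
def Cert.Dl (σ : Fin 2) : ℕ :=
  sumFin (2 * (2 * r) + 1) fun a => sumFin (2 * (2 * r) + 1) fun b => c.C σ a b

/-- Shrink factor `a_σ = 2^{2P} / (2^{2P} + 2Δ_σ)`. [cite: BachLiebSolovej1994, eq. (2c.4)] -/
def Cert.A (σ : Fin 2) : ℚ := (2 : ℚ) ^ (2 * c.P) / ((2 : ℚ) ^ (2 * c.P) + 2 * (c.Dl σ : ℚ))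

/-- Shrink offset `b_σ = a_σ Δ_σ / 2^{2P}`. [cite: BachLiebSolovej1994, eq. (2c.4)] -/
def Cert.B (σ : Fin 2) : ℚ := (c.Dl σ : ℚ) * c.A σ / (2 : ℚ) ^ (2 * c.P)

/-- **Entry of the SHRUNK kernel** `γ_σ(R)[p, q] = a_σ g/2^P + b_σ [R = 0][p = q]` (exact rational).
[cite: BachLiebSolovej1994, eq. (2c.4)] -/
def Cert.gs (σ : Fin 2) (R₀ R₁ : ℤ) (p q : Site M) : ℚ :=
  c.A σ * (c.gZ σ R₀ R₁ p q : ℚ) / (2 : ℚ) ^ c.P + if R₀ = 0 ∧ R₁ = 0 ∧ p = q then c.B σ else 0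

variable [∀ i, NeZero (M i)]

/-- The site `p + e₀` (wrapping inside the cell). [folklore] -/
def wrap₀ (p : Site M) : Site M := (p.1 + 1, p.2)

/-- The site `p + e₁` (wrapping inside the cell). [folklore] -/
def wrap₁ (p : Site M) : Site M := (p.1, p.2 + 1)

/-- The face-shift coordinate of the bond `p → p + e₀`: `0` inside the cell, `-1` across the face.
[folklore] -/
def fs₀ (p : Site M) : ℤ := if p.1.val + 1 < M 0 then 0 else -1

/-- The face-shift coordinate of the bond `p → p + e₁`. [folklore] -/
def fs₁ (p : Site M) : ℤ := if p.2.val + 1 < M 1 then 0 else -1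

/-- Recomputed filling `Σ_σ Σ_p γ_σ(0)[p,p] / |cell|`. [cite: BachLiebSolovej1994, eq. (2c.8)] -/
def Cert.nQ : ℚ := (sumFin 2 fun σ => sumSite M fun p => c.gs σ 0 0 p p) / ((M 0 : ℚ) * M 1)

/-- Recomputed nearest-neighbour bond sum of the shrunk kernel (the sum inside `qfCellEnergy`).
[cite: BachLiebSolovej1994, eq. (2c.8)] -/
def Cert.bondQ : ℚ :=
  sumFin 2 fun σ => sumSite M fun p =>
    (c.gs σ (fs₀ p) 0 (wrap₀ p) p + c.gs σ (-fs₀ p) 0 p (wrap₀ p)) +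
      (c.gs σ 0 (fs₁ p) (wrap₁ p) p + c.gs σ 0 (-fs₁ p) p (wrap₁ p))

/-- Recomputed `K = re qfCellEnergy 1 0 γ / |cell|`. [cite: BachLiebSolovej1994, eq. (2c.8)] -/
def Cert.KQ : ℚ := -c.bondQ / ((M 0 : ℚ) * M 1)

/-- Recomputed diagonal-bond sum of the shrunk kernel (the sum `qfCellDiag`).
[cite: BachLiebSolovej1994, eq. (2c.8)] -/
def Cert.diagQ : ℚ :=
  sumFin 2 fun σ => sumSite M fun p =>
    c.gs σ (fs₀ p) (fs₁ p) (wrap₁ (wrap₀ p)) p + c.gs σ (-fs₀ p) (-fs₁ p) p (wrap₁ (wrap₀ p)) +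
      c.gs σ (fs₀ p) (-fs₁ p) (wrap₀ p) (wrap₁ p) + c.gs σ (-fs₀ p) (fs₁ p) (wrap₁ p) (wrap₀ p)

/-- Recomputed `K_d = re qfCellDiag γ / |cell|`. [cite: BachLiebSolovej1994, eq. (2c.8)] -/
def Cert.KdQ : ℚ := c.diagQ / ((M 0 : ℚ) * M 1)

/-- Recomputed `D = re qfCellEnergy 0 1 γ / |cell| = Σ_p γ_↑(0)[p,p] γ_↓(0)[p,p] / |cell|`.
[cite: BachLiebSolovej1994, eq. (2c.8)] -/
def Cert.DQ : ℚ := (sumSite M fun p => c.gs 0 0 0 p p * c.gs 1 0 0 p p) / ((M 0 : ℚ) * M 1)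

/-- **Numbers check**: the claimed `n, K, Kd, D` are the exact recomputed values.
[cite: Neumaier2004CompleteSearch, §11] -/
def Cert.checkNumbers : Bool :=
  decide (c.nQ = c.n) && decide (c.KQ = c.K) && decide (c.KdQ = c.Kd) && decide (c.DQ = c.D)

omit [∀ i, NeZero (M i)] in
/-- **Basic check**: cell sides `≥ 2` and filling in `(0, 2)`. [cite: BachLiebSolovej1994, eq. (2c.36)] -/
def Cert.checkBasic : Bool :=
  decide (2 ≤ M 0) && decide (2 ≤ M 1) && decide (0 < c.n) && decide (c.n < 2)

end QFK

end HartreeFock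

end Literature.MathematicalPhysics.QuantumLattice
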